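import Literature.Probability.LatticeModels.SixVertexSpectralXi
import Literature.Probability.LatticeModels.SixVertexSpectralUpperBoundOnB
import Literature.Probability.LatticeModels.SixVertexSpectralLastIdentity
import Mathlib.Analysis.Complex.RealDeriv
import Mathlib.Analysis.Calculus.Deriv.MeanValue

/-!
# Six-vertex spectral measures: `Ξ` is non-increasing (DKLM 2026, Part II, Theorem 46)

H. Duminil-Copin, K. K. Kozlowski, P. Lammers, I. Manolescu, *Gaussian free field convergence of
the six-vertex model with `-1 ≤ Δ ≤ -1/2`*, arXiv:2603.06268 (2026) [DKLM2026SixVertexGFF]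
(`paper:arxiv-2603.06268`, chunks p0029–p0030):

> `Ξ : ℝ_{>0} → ℝ_{≥0}, s ↦ -sI_F'(s) = sF(s,0)`. Note that `I_F(s) ∝ -log s` if and only if `Ξ` is
> constant.
>
> **Theorem 46.** For any convergence sequence `(δ_n)_n`, the function `Ξ` is bounded and
> `-Ξ'(s) = s ΔI_F(|u|)|_{u=se₁} = s ∫ (a²-b²) e^{-as} dμ(a,b) ≥ 0`. In particular, `Ξ` is a
> non-increasing function.
>
> *Proof.* […] The bounds on `μ ∈ 𝓜` thus imply that `Ξ` is bounded. […] The equality on the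
> right of (eq:non-increasing) is Theorem 40. For the equality on the left, note that the radial
> symmetry of `I_F(|·|)` enables us to replace `∂_x` by `s∂_{yy}` […]
> `ΔI_F(|u|)|_{u=se₁} = ∫ (a²-b²) e^{-as} dμ(a,b)` (eq:identifying Delta I). We used that we may
> differentiate under the integral thanks to the dominated convergence theorem, using that
> `a ∧ 1/a` is integrable, and that `|b| ≤ a` (Theorem 40).
>
> […] define `σ, σ' ∈ ℝ_{≥0}` such that `σ²/2π = lim_{s→0} -sI_F'(s) > lim_{s→∞} -sI_F'(s) = (σ')²/2π`.

For `μ ∈ 𝓜_{c,C}` (boundedness of `Ξ` is `abs_dklmXi_le` of `SixVertexSpectralXi.lean`):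

* `hasDerivAt_dklmF_re` (`∂_s F(s,0) = -∫ a² e^{-as} dμ`, Lemma 37 (iii) on the real axis),
  `hasDerivAt_dklmXi` (`Ξ'(s) = F(s,0) - s ∫ a² e^{-as} dμ`), `dklmXi_nonneg`
  (integrability of `a² e^{-as}`, `b² e^{-as}`: `SixVertexSpectralLastIdentity.lean`);
* **Theorem 46** conditionally on the two consequences of rotational invariance it uses:
  the rotation formula `hrot` of Lemma 38 (iii)/Lemma 43 (through Theorem 40,
  `SixVertexSpectralUpperBoundOnB.lean`) and the `∂_{yy}`-component of eq. (identifying Delta I),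
  `F(s,0) = s ∫ b² e^{-as} dμ` (`hLap`; with `∂_{xx} I_F(|u|) = ∫ a² e^{-as} dμ` and
  `∂_{yy} I_F(|u|)|_{se₁} = I_F'(s)/s = -F(s,0)/s`, eq. (identifying Delta I) is exactly this
  identity; `SixVertexSpectralLastIdentity.lean` derives `hLap` from the vertical case of
  eq. (last_identity)): **`hasDerivAt_dklmXi_eq`** (`-Ξ'(s) = s ∫ (a²-b²) e^{-as} dμ`), `integral_sq_sub_sq_mul_exp_nonneg`
  (`≥ 0`, Theorem 40), **`antitoneOn_dklmXi`** (`Ξ` is non-increasing on `(0,∞)`);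
* the two limits of the proof of Theorem 27: `tendsto_dklmXi_nhdsGT_zero` (`lim_{s→0⁺} Ξ`) and
  `tendsto_dklmXi_atTop` (`lim_{s→∞} Ξ`), with `sInf ≤ sSup`;
* `antitoneOn_dklmXi_of_lastIdentity` — Theorem 46 with the hypotheses `hrot` (Lemma 38 (iii)) and
  the vertical case of eq. (last_identity).

## References

* H. Duminil-Copin, K. K. Kozlowski, P. Lammers, I. Manolescu, arXiv:2603.06268 (2026), Part II,
  §1.5, Theorem 46 and eq. (identifying Delta I); proof of Theorem 27 (eq. (eq:o)).
  [DKLM2026SixVertexGFF]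
-/

noncomputable section

open MeasureTheory Set Filter Topology Complex

namespace Literature.Probability.LatticeModels.SixVertex

variable {c C : ℝ} {μ : Measure (ℝ × ℝ)}

/-! ## 1. Derivatives of `F(s,0)` and `Ξ` on the real axis -/

/-- **`∂_s F(s,0) = -∫ a² e^{-as} dμ`** for real `s > 0` (Lemma 37 (iii) restricted to the real
axis). [cite: DKLM2026SixVertexGFF, Part II, Lemma 37 (iii)] -/
theorem hasDerivAt_dklmF_re (h : μ ∈ dklmSpaceM c C) {s : ℝ} (hs : 0 < s) :
    HasDerivAt (fun x : ℝ => (dklmF μ x 0).re) (-∫ p, p.1 ^ 2 * Real.exp (-(p.1 * s)) ∂μ) s := by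
  have hd := (hasDerivAt_dklmF h (x₀ := (s : ℂ)) (by simpa using hs) 0).real_of_complex
  convert hd using 1
  have hfun : (fun p : ℝ × ℝ => -(p.1 : ℂ) * fKernel (s : ℂ) 0 p) =
      fun p : ℝ × ℝ => ((-(p.1 ^ 2 * Real.exp (-(p.1 * s))) : ℝ) : ℂ) := by
    funext p
    simp only [fKernel, Complex.ofReal_zero, mul_zero, add_zero]
    push_cast
    ring
  have hI : (∫ p : ℝ × ℝ, ((-(p.1 ^ 2 * Real.exp (-(p.1 * s))) : ℝ) : ℂ) ∂μ) =
      ((∫ p : ℝ × ℝ, -(p.1 ^ 2 * Real.exp (-(p.1 * s))) ∂μ : ℝ) : ℂ) := integral_ofReal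
  rw [hfun, hI, Complex.ofReal_re, integral_neg]

/-- **`Ξ'(s) = F(s,0) - s ∫ a² e^{-as} dμ`** for `s > 0`. [cite: DKLM2026SixVertexGFF, Part II §1.5, eq. (def Xi)] -/
theorem hasDerivAt_dklmXi (h : μ ∈ dklmSpaceM c C) {s : ℝ} (hs : 0 < s) :
    HasDerivAt (dklmXi μ) ((dklmF μ s 0).re - s * ∫ p, p.1 ^ 2 * Real.exp (-(p.1 * s)) ∂μ) s := by
  have h1 := (hasDerivAt_id s).mul (hasDerivAt_dklmF_re h hs)
  refine (h1.congr_of_eventuallyEq (Eventually.of_forall fun x => rfl)).congr_deriv ?_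
  simp only [id]
  ring

/-- `F(s,0) ≥ 0` for real `s` (`= ∫ a e^{-as} dμ`, `μ` carried by `a > 0`). [cite: DKLM2026SixVertexGFF, Part II, Definition 36] -/
theorem dklmF_re_nonneg (h : μ ∈ dklmSpaceM c C) (s : ℝ) : 0 ≤ (dklmF μ s 0).re := by
  rw [dklmF_ofReal_zero, Complex.ofReal_re]
  refine integral_nonneg_of_ae ?_
  filter_upwards [dklmSpaceM_ae_pos h] with p hp
  positivity

/-- **`Ξ ≥ 0`** (`Ξ : ℝ_{>0} → ℝ_{≥0}`). [cite: DKLM2026SixVertexGFF, Part II §1.5, eq. (def Xi)] -/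
theorem dklmXi_nonneg (h : μ ∈ dklmSpaceM c C) {s : ℝ} (hs : 0 ≤ s) : 0 ≤ dklmXi μ s :=
  mul_nonneg hs (dklmF_re_nonneg h s)

/-! ## 2. Theorem 46 -/

/-- **Theorem 46, the derivative**: `-Ξ'(s) = s ∫ (a²-b²) e^{-as} dμ` for `s > 0`, given the
rotation formula of Lemma 38 (iii) (`hrot`, for `|b| ≤ a`) and the `∂_{yy}`-component of
eq. (identifying Delta I), `F(s,0) = s ∫ b² e^{-as} dμ` (`hLap`).
[cite: DKLM2026SixVertexGFF, Part II, Theorem 46, eq. (non-increasing)] -/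
theorem hasDerivAt_dklmXi_eq (h : μ ∈ dklmSpaceM c C)
    (hrot : ∀ x y : ℝ, 0 < x →
      dklmF μ x y = ((x / Real.sqrt (x ^ 2 + y ^ 2) : ℝ) : ℂ) * dklmF μ (Real.sqrt (x ^ 2 + y ^ 2) : ℝ) 0)
    (hLap : ∀ s : ℝ, 0 < s → (dklmF μ s 0).re = s * ∫ p, p.2 ^ 2 * Real.exp (-(p.1 * s)) ∂μ)
    {s : ℝ} (hs : 0 < s) :
    HasDerivAt (dklmXi μ) (-(s * ∫ p, (p.1 ^ 2 - p.2 ^ 2) * Real.exp (-(p.1 * s)) ∂μ)) s := by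
  refine (hasDerivAt_dklmXi h hs).congr_deriv ?_
  rw [hLap s hs]
  have hsplit : ∫ p, (p.1 ^ 2 - p.2 ^ 2) * Real.exp (-(p.1 * s)) ∂μ =
      (∫ p, p.1 ^ 2 * Real.exp (-(p.1 * s)) ∂μ) - ∫ p, p.2 ^ 2 * Real.exp (-(p.1 * s)) ∂μ := by
    rw [← integral_sub (integrable_sq_mul_exp h hs) (integrable_sq_snd_mul_exp h (dklm_ae_abs_le h hrot) hs)]
    refine integral_congr_ae (Eventually.of_forall fun p => ?_)
    ring
  rw [hsplit]
  ring

/-- **Theorem 46, the sign**: `∫ (a²-b²) e^{-as} dμ ≥ 0` ("the equality on the right of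
(eq:non-increasing) is Theorem 40"). [cite: DKLM2026SixVertexGFF, Part II, Theorem 46] -/
theorem integral_sq_sub_sq_mul_exp_nonneg (h : μ ∈ dklmSpaceM c C)
    (hrot : ∀ x y : ℝ, 0 < x →
      dklmF μ x y = ((x / Real.sqrt (x ^ 2 + y ^ 2) : ℝ) : ℂ) * dklmF μ (Real.sqrt (x ^ 2 + y ^ 2) : ℝ) 0)
    (s : ℝ) : 0 ≤ ∫ p, (p.1 ^ 2 - p.2 ^ 2) * Real.exp (-(p.1 * s)) ∂μ := by
  refine integral_nonneg_of_ae ?_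
  filter_upwards [dklm_ae_abs_le h hrot] with p hp
  have : p.2 ^ 2 ≤ p.1 ^ 2 := by nlinarith [abs_nonneg p.2, sq_abs p.2]
  exact mul_nonneg (by linarith) (Real.exp_pos _).le

/-- `Ξ` is continuous on `(0, ∞)`. [cite: DKLM2026SixVertexGFF, Part II, Theorem 46] -/
theorem continuousOn_dklmXi (h : μ ∈ dklmSpaceM c C) : ContinuousOn (dklmXi μ) (Ioi 0) :=
  fun _ hs => (hasDerivAt_dklmXi h hs).continuousAt.continuousWithinAt

/-- **Theorem 46 ("in particular, `Ξ` is a non-increasing function")**: `Ξ` is antitone on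
`(0,∞)`, given `hrot` (Lemma 38 (iii)) and `hLap` (eq. (identifying Delta I)).
[cite: DKLM2026SixVertexGFF, Part II, Theorem 46] -/
theorem antitoneOn_dklmXi (h : μ ∈ dklmSpaceM c C)
    (hrot : ∀ x y : ℝ, 0 < x →
      dklmF μ x y = ((x / Real.sqrt (x ^ 2 + y ^ 2) : ℝ) : ℂ) * dklmF μ (Real.sqrt (x ^ 2 + y ^ 2) : ℝ) 0)
    (hLap : ∀ s : ℝ, 0 < s → (dklmF μ s 0).re = s * ∫ p, p.2 ^ 2 * Real.exp (-(p.1 * s)) ∂μ) :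
    AntitoneOn (dklmXi μ) (Ioi 0) := by
  refine antitoneOn_of_deriv_nonpos (convex_Ioi 0) (continuousOn_dklmXi h) ?_ ?_
  · rw [interior_Ioi]
    exact fun s hs => (hasDerivAt_dklmXi h hs).differentiableAt.differentiableWithinAt
  · rw [interior_Ioi]
    intro s hs
    rw [(hasDerivAt_dklmXi_eq h hrot hLap hs).deriv, neg_nonpos]
    exact mul_nonneg (le_of_lt hs) (integral_sq_sub_sq_mul_exp_nonneg h hrot s)

/-! ## 3. The limits `lim_{s→0⁺} Ξ` and `lim_{s→∞} Ξ` (proof of Theorem 27) -/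

/-- `Ξ` is bounded above on `(0,∞)` (Theorem 46, first assertion). [cite: DKLM2026SixVertexGFF, Part II, Theorem 46] -/
theorem bddAbove_dklmXi_image (h : μ ∈ dklmSpaceM c C) : BddAbove (dklmXi μ '' Ioi 0) := by
  refine ⟨24 * max C 0, ?_⟩
  rintro _ ⟨s, hs, rfl⟩
  exact (le_abs_self _).trans (abs_dklmXi_le h hs)

/-- `Ξ` is bounded below (by `0`) on `(0,∞)`. [cite: DKLM2026SixVertexGFF, Part II §1.5] -/
theorem bddBelow_dklmXi_image (h : μ ∈ dklmSpaceM c C) : BddBelow (dklmXi μ '' Ioi 0) := by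
  refine ⟨0, ?_⟩
  rintro _ ⟨s, hs, rfl⟩
  exact dklmXi_nonneg h (le_of_lt hs)

/-- **`σ²/2π := lim_{s→0⁺} Ξ(s)` exists** (and equals `sup_{(0,∞)} Ξ`), `Ξ` being non-increasing and
bounded. [cite: DKLM2026SixVertexGFF, Part II, proof of Theorem 27, eq. (eq:o)] -/
theorem tendsto_dklmXi_nhdsGT_zero (h : μ ∈ dklmSpaceM c C)
    (hrot : ∀ x y : ℝ, 0 < x →
      dklmF μ x y = ((x / Real.sqrt (x ^ 2 + y ^ 2) : ℝ) : ℂ) * dklmF μ (Real.sqrt (x ^ 2 + y ^ 2) : ℝ) 0)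
    (hLap : ∀ s : ℝ, 0 < s → (dklmF μ s 0).re = s * ∫ p, p.2 ^ 2 * Real.exp (-(p.1 * s)) ∂μ) :
    Tendsto (dklmXi μ) (𝓝[>] 0) (𝓝 (sSup (dklmXi μ '' Ioi 0))) :=
  (antitoneOn_dklmXi h hrot hLap).tendsto_nhdsGT (bddAbove_dklmXi_image h)

/-- **`(σ')²/2π := lim_{s→∞} Ξ(s)` exists** (and equals `inf_{(0,∞)} Ξ`).
[cite: DKLM2026SixVertexGFF, Part II, proof of Theorem 27, eq. (eq:o)] -/
theorem tendsto_dklmXi_atTop (h : μ ∈ dklmSpaceM c C)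
    (hrot : ∀ x y : ℝ, 0 < x →
      dklmF μ x y = ((x / Real.sqrt (x ^ 2 + y ^ 2) : ℝ) : ℂ) * dklmF μ (Real.sqrt (x ^ 2 + y ^ 2) : ℝ) 0)
    (hLap : ∀ s : ℝ, 0 < s → (dklmF μ s 0).re = s * ∫ p, p.2 ^ 2 * Real.exp (-(p.1 * s)) ∂μ) :
    Tendsto (dklmXi μ) atTop (𝓝 (sInf (dklmXi μ '' Ioi 0))) := by
  have hanti := antitoneOn_dklmXi h hrot hLap
  -- `Ξ ∘ exp` is antitone on `ℝ`
  have hA : Antitone (dklmXi μ ∘ Real.exp) := fun u v huv =>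
    hanti (Real.exp_pos u) (Real.exp_pos v) (Real.exp_le_exp.2 huv)
  have hrange : range (dklmXi μ ∘ Real.exp) = dklmXi μ '' Ioi 0 := by
    ext z
    simp only [mem_range, Function.comp_apply, mem_image, mem_Ioi]
    constructor
    · rintro ⟨u, rfl⟩; exact ⟨Real.exp u, Real.exp_pos u, rfl⟩
    · rintro ⟨s, hs, rfl⟩; exact ⟨Real.log s, by rw [Real.exp_log hs]⟩
  have hbdd : BddBelow (range (dklmXi μ ∘ Real.exp)) := hrange ▸ bddBelow_dklmXi_image h
  have hlim := tendsto_atTop_ciInf hA hbdd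
  rw [← sInf_range, hrange] at hlim
  rw [← Real.map_exp_atTop, tendsto_map'_iff]
  exact hlim

/-- `lim_{s→∞} Ξ ≤ lim_{s→0⁺} Ξ` (`(σ')² ≤ σ²`). [cite: DKLM2026SixVertexGFF, Part II, proof of Theorem 27, eq. (eq:o)] -/
theorem sInf_dklmXi_le_sSup (h : μ ∈ dklmSpaceM c C) : sInf (dklmXi μ '' Ioi 0) ≤ sSup (dklmXi μ '' Ioi 0) :=
  have hmem : dklmXi μ 1 ∈ dklmXi μ '' Ioi 0 := ⟨1, mem_Ioi.2 one_pos, rfl⟩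
  (csInf_le (bddBelow_dklmXi_image h) hmem).trans (le_csSup (bddAbove_dklmXi_image h) hmem)

/-- **Theorem 46 from Lemma 38 (iii) and eq. (last_identity)**: `Ξ` is non-increasing on `(0,∞)`
for `μ ∈ 𝓜_{c,C}` satisfying the rotation formula `hrot` and the vertical case of
eq. (last_identity), `I_F(√(s²+y²)) - I_F(s) = ∫ e^{-as}(cos(by) - 1) dμ`.
[cite: DKLM2026SixVertexGFF, Part II, Theorem 46 (proof via eq. (last_identity))] -/
theorem antitoneOn_dklmXi_of_lastIdentity (h : μ ∈ dklmSpaceM c C)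
    (hrot : ∀ x y : ℝ, 0 < x →
      dklmF μ x y = ((x / Real.sqrt (x ^ 2 + y ^ 2) : ℝ) : ℂ) * dklmF μ (Real.sqrt (x ^ 2 + y ^ 2) : ℝ) 0)
    (hlast0 : ∀ s : ℝ, 0 < s → ∀ y : ℝ,
      dklmIF μ (Real.sqrt (s ^ 2 + y ^ 2)) - dklmIF μ s = ∫ p, Real.exp (-(p.1 * s)) * (Real.cos (p.2 * y) - 1) ∂μ) :
    AntitoneOn (dklmXi μ) (Ioi 0) :=
  antitoneOn_dklmXi h hrot fun _ hs => dklmF_re_eq_of_lastIdentity h (dklm_ae_abs_le h hrot) hlast0 hs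

end Literature.Probability.LatticeModels.SixVertex

end
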